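import Summits.QuantumAdvantage.QuantumAdvantage.Theorems.MobiusLadderLiouvilleNotPPolyOneTimePadDefs
import Literature.Computability.Complexity.TruthTableClosure
import Literature.Computability.Complexity.PPolyTuringClosure
import Literature.Computability.Complexity.CodeFPArith
import Literature.Computability.Complexity.CoinBlocksOr
import Literature.Computability.QuantumComplexity.AnnotatedPairCountsPSpace
import HarnessLib

/-!
# Crux `MobiusLadder.LiouvilleNotPPoly` (stmt-QuantumAdvantage-1389), line `SketchIdeator4`, stub `stub_padOracle`

The complexity half of T1 of the line (multiplicative one-time pad): for every `L' ∈ P/poly` and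
every threshold `n₀`, the pad oracle `padOracle L' n₀` is in `P/poly`.

Proof. `padOracle L' n₀` is a two-query polynomial-time truth-table reduction to `L'`
(Ladner–Lynch–Selman 1975, §3), in the tree's format `ttLang Q q D L'` of
`TruthTableClosure.lean` with `q = 2`:

* the query generator `Q ⟨w, 1ⁱ⟩` asks `bin(N · r)` for `i = 0` and `bin(r) = y1` for `i = 1`, where
  `w` is read as `⟨x, y⟩` through `fstP`/`sndP`, `N = ⟦x⟧` and `r = 2^{|y|} + ⟦y⟧ = ⟦y 1⟧`
  (`bitsToNat_append_true`; `bin ⟦y1⟧ = y1` since `y1` is a canonical numeral);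
* the evaluator `D` accepts `⟨w, b₀ b₁⟩` iff `|x| ≥ n₀`, `x` is canonical (`bin ⟦x⟧ = x`) and
  `b₀ ≠ b₁`, i.e. `[bin(N r) ∈ L'] ↔ [bin(r) ∉ L']`.

`Q ∈ FP` and `D ∈ P` are assembled from the typed `CodeFP` combinators (`strVal`, `strOfNat`,
`natMul`, `strAppend`, `strLength`, `natLeUn`, `eq`, `ite`, `and`, `or`; strings coded by themselves,
`strE`), so `padOracle L' n₀ = ttLang Q 2 D L' ∈ P^{L'} ⊆ P^{P/poly} ⊆ P/poly`
(`ttLang_mem_PRelClass`, `PRelClass_PPoly_subset_PPoly`: Arora–Barak 2009, Thm. 6.18 with Def. 6.5).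

Sources: R. E. Ladner, N. A. Lynch, A. L. Selman, *A comparison of polynomial time
reducibilities*, TCS 1 (1975), §3; S. Arora, B. Barak, *Computational Complexity* (2009), §6.
Everything used is proved tree material; sorry-free.
-/

set_option linter.dupNamespace false -- D-0017: single-problem summit ⇒ `QuantumAdvantage.QuantumAdvantage` by design

noncomputable section

namespace Summit.QuantumAdvantage.QuantumAdvantage.Theorems.LiouvilleNotPPoly.OneTimePad

open Literature.Computability.Complexity
open Literature.Probability.RandomGraphs.LowDegree (sgn sgn_true sgn_false)
open _root_.Computability Filter Finset Polynomial
open Summit.QuantumAdvantage.QuantumAdvantage.Theorems.LiouvilleOrthogonalTC0 (bits ofBits lamBit)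

namespace PadOracle

open Literature.Computability.Complexity.CodeFP (pairE strE natE unE bitE)
open Literature.Computability.QuantumComplexity.ADH.PCSpec (fstP_code sndP_code mem_FP_of_code)
open Literature.Computability.Complexity.CoinBlocks (mem_setOf_language)

/-! ### Numerals: the multiplier `r = 2^{|y|} + ⟦y⟧` is the canonical numeral `y 1` -/

/-- `⟦y 1⟧ = 2^{|y|} + ⟦y⟧` (least significant bit first). [folklore] -/
theorem bitsToNat_append_true_eq (y : List Bool) :
    bitsToNat (y ++ [true]) = 2 ^ y.length + bitsToNat y := by
  rw [bitsToNat_append_true, add_comm]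

/-- `bin (2^{|y|} + ⟦y⟧) = y 1`: a string ending in `1` is a canonical numeral. [folklore] -/
theorem encodeNat_two_pow_add_bitsToNat (y : List Bool) :
    encodeNat (2 ^ y.length + bitsToNat y) = y ++ [true] := by
  rw [← bitsToNat_append_true_eq, encodeNat_bitsToNat (isCanonicalNum_append_true y)]

/-! ### Bridges: `CodeFP` statements on self-coded strings
(`fstP_code`, `sndP_code`, `mem_FP_of_code` are reused from `ADH.PCSpec`, `mem_setOf_language` from `CoinBlocks`) -/

/-- A language whose indicator bit is computed on self-coded strings is in `P`
(`mem_P_of_mem_FP`). [cite: AroraBarak2009, Def. 1.13] -/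
theorem mem_P_of_codeFP {L : Language Bool} {b : List Bool → Bool} (hb : CodeFP strE bitE b)
    (h : ∀ z, b z = true ↔ z ∈ L) : L ∈ Classes.P := by
  obtain ⟨g, hg, hgb⟩ := hb
  refine mem_P_of_mem_FP hg L fun z => ⟨fun hz => ?_, fun hz => ?_⟩
  · have e : g z = [b z] := hgb z
    rw [e, (h z).2 hz]
  · have e : g z = [b z] := hgb z
    rw [e]
    cases hbz : b z with
    | false => rfl
    | true => exact absurd ((h z).1 hbz) hz

/-! ### The query generator is in `FP` -/

/-- **The query generator on codes.** On `z = ⟨w, u⟩` with `w = ⟨x, y⟩`: if `u = ε` (query `0`) the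
numeral `bin (⟦x⟧ · ⟦y 1⟧)`, otherwise (query `1`) the string `y 1`; a typed `CodeFP` assembly
(`strVal`, `natMul`, `strOfNat`, `strAppend`, equality test with `ε`, `ite`).
[cite: AroraBarak2009, §1.3] -/
theorem qry_codeFP : CodeFP strE strE (fun z : List Bool =>
    if (sndP z).isEmpty then encodeNat (bitsToNat (fstP (fstP z)) * bitsToNat (sndP (fstP z) ++ [true]))
    else sndP (fstP z) ++ [true]) := by
  have hx : CodeFP strE strE (fun z => fstP (fstP z)) := fstP_code.comp fstP_code
  have hy1 : CodeFP strE strE (fun z => sndP (fstP z) ++ [true]) :=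
    CodeFP.strAppend.comp ((sndP_code.comp fstP_code).pair (CodeFP.const strE (eβ := strE) [true]))
  have htest : CodeFP strE bitE (fun z => (sndP z).isEmpty) :=
    ((CodeFP.eq (eα := strE) Function.injective_id).comp
      (sndP_code.pair (CodeFP.const strE (eβ := strE) ([] : List Bool)))).congr fun z => by
        cases sndP z <;> simp
  have hq0 : CodeFP strE strE
      (fun z => natE (bitsToNat (fstP (fstP z)) * bitsToNat (sndP (fstP z) ++ [true]))) :=
    CodeFP.strOfNat.comp (CodeFP.natMul.comp ((CodeFP.strVal.comp hx).pair (CodeFP.strVal.comp hy1)))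
  exact htest.ite hq0 hy1

/-- Hence the query generator is an `FP` string function. [cite: AroraBarak2009, §1.3] -/
theorem qry_mem_FP : (fun z : List Bool =>
    if (sndP z).isEmpty then encodeNat (bitsToNat (fstP (fstP z)) * bitsToNat (sndP (fstP z) ++ [true]))
    else sndP (fstP z) ++ [true]) ∈ FP :=
  mem_FP_of_code qry_codeFP

/-! ### The evaluator is in `P` -/

/-- **The evaluator bit on codes.** On `z = ⟨⟨x, y⟩, u⟩`:
`[n₀ ≤ |x|] ∧ [bin ⟦x⟧ = x] ∧ ([u = 10] ∨ [u = 01])` (`strLength`, `natLeUn`, `strVal`, `strOfNat`,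
`eq`, `and`, `or`). [cite: AroraBarak2009, §1.3] -/
theorem dec_codeFP (n₀ : ℕ) : CodeFP strE bitE (fun z : List Bool =>
    decide (n₀ ≤ (fstP (fstP z)).length) &&
      (decide (encodeNat (bitsToNat (fstP (fstP z))) = fstP (fstP z)) &&
        (decide (sndP z = [true, false]) || decide (sndP z = [false, true])))) := by
  have hx : CodeFP strE strE (fun z => fstP (fstP z)) := fstP_code.comp fstP_code
  have hlen : CodeFP strE bitE (fun z => decide (n₀ ≤ (fstP (fstP z)).length)) :=
    CodeFP.natLeUn.comp ((CodeFP.const strE (eβ := natE) n₀).pair (CodeFP.strLength.comp hx))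
  have hcanon : CodeFP strE bitE
      (fun z => decide (encodeNat (bitsToNat (fstP (fstP z))) = fstP (fstP z))) :=
    (CodeFP.eq (eα := strE) Function.injective_id).comp
      ((CodeFP.strOfNat.comp (CodeFP.strVal.comp hx)).pair hx)
  have h10 : CodeFP strE bitE (fun z => decide (sndP z = [true, false])) :=
    ((CodeFP.eq (eα := strE) Function.injective_id).comp
      (sndP_code.pair (CodeFP.const strE (eβ := strE) [true, false]))).congr fun z => by simp
  have h01 : CodeFP strE bitE (fun z => decide (sndP z = [false, true])) :=
    ((CodeFP.eq (eα := strE) Function.injective_id).comp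
      (sndP_code.pair (CodeFP.const strE (eβ := strE) [false, true]))).congr fun z => by simp
  exact hlen.and (hcanon.and (h10.or h01))

/-- **The evaluator language is in `P`.** [cite: AroraBarak2009, §1.3] -/
theorem dec_mem_P (n₀ : ℕ) :
    ({z | n₀ ≤ (fstP (fstP z)).length ∧ encodeNat (bitsToNat (fstP (fstP z))) = fstP (fstP z) ∧
        (sndP z = [true, false] ∨ sndP z = [false, true])} : Language Bool) ∈ Classes.P :=
  mem_P_of_codeFP (dec_codeFP n₀) fun z => by
    rw [mem_setOf_language]
    simp only [Bool.and_eq_true, Bool.or_eq_true, decide_eq_true_eq]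

/-! ### `padOracle` is the truth-table language -/

/-- Two answer bits. [folklore] -/
theorem ttBits_two (Q : List Bool → List Bool) (A : Language Bool) (x : List Bool) :
    ttBits Q A x 2 = [A.boolIndicator (Q (boolPair x [])), A.boolIndicator (Q (boolPair x [true]))] := by
  rw [show (2 : ℕ) = 0 + 1 + 1 from rfl, ttBits_succ, ttBits_succ]
  simp [ttBits]

/-- The evaluator's test on the two answer bits: `b₀ b₁ ∈ {10, 01}` iff `(u ∈ L ↔ v ∉ L)`. [folklore] -/
theorem indicator_pair_iff (L : Language Bool) (u v : List Bool) :
    ([L.boolIndicator u, L.boolIndicator v] = [true, false] ∨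
        [L.boolIndicator u, L.boolIndicator v] = [false, true]) ↔ (u ∈ L ↔ v ∉ L) := by
  rw [← boolIndicator_eq_true_iff' L u, ← boolIndicator_eq_true_iff' L v]
  cases L.boolIndicator u <;> cases L.boolIndicator v <;> simp

/-- **`padOracle L' n₀` is the two-query truth-table language** `ttLang Q 2 D L'` of the query
generator and evaluator above. [cite: LadnerLynchSelman1975, §3] -/
theorem padOracle_eq_ttLang (L' : Language Bool) (n₀ : ℕ) :
    padOracle L' n₀ =
      ttLang (fun z : List Bool =>
          if (sndP z).isEmpty then
            encodeNat (bitsToNat (fstP (fstP z)) * bitsToNat (sndP (fstP z) ++ [true]))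
          else sndP (fstP z) ++ [true])
        (Polynomial.C 2)
        {z | n₀ ≤ (fstP (fstP z)).length ∧ encodeNat (bitsToNat (fstP (fstP z))) = fstP (fstP z) ∧
          (sndP z = [true, false] ∨ sndP z = [false, true])} L' := by
  ext w
  rw [mem_ttLang_iff, Polynomial.eval_C, ttBits_two, mem_setOf_language]
  simp only [fstP_boolPair, sndP_boolPair, List.isEmpty_nil, List.isEmpty_cons, if_true, if_false,
    Bool.false_eq_true]
  rw [bitsToNat_append_true_eq, ← encodeNat_two_pow_add_bitsToNat, indicator_pair_iff]
  rfl

end PadOracle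

/-- **STUB T1a · `stub_padOracle` — THE PAD ORACLE OF A `P/poly` LANGUAGE IS IN `P/poly`.**
`padOracle L' n₀` is a two-query polynomial-time truth-table reduction to `L'` (queries `bin(N r)` and
`bin(r)`, `r = 2^{|y|} + ⟦y⟧`; evaluator: `|x| ≥ n₀`, `x` canonical, answer bits differ), hence in
`P^{L'} ⊆ P^{P/poly} ⊆ P/poly` (`ttLang_mem_PRelClass`, `PRelClass_PPoly_subset_PPoly`).
[cite: LadnerLynchSelman1975, §3] [cite: AroraBarak2009, Thm. 6.18] -/
theorem stub_padOracle : ∀ L' ∈ PPoly, ∀ n₀ : ℕ, padOracle L' n₀ ∈ PPoly := by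
  intro L' hL' n₀
  rw [PadOracle.padOracle_eq_ttLang L' n₀]
  exact PRelClass_PPoly_subset_PPoly
    (ttLang_mem_PRelClass PadOracle.qry_mem_FP (PadOracle.dec_mem_P n₀) hL')

end Summit.QuantumAdvantage.QuantumAdvantage.Theorems.LiouvilleNotPPoly.OneTimePad

end
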